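import Summits.HubbardSuperconductivity.HubbardLadder.ObservableWindow
import Literature.MathematicalPhysics.QuantumLattice.HubbardHalfFilledGroundStateTorus
import Literature.MathematicalPhysics.QuantumLattice.HubbardBootstrapCertificate
import Literature.MathematicalPhysics.QuantumLattice.FermionOperatorsSpinHermitianProofs
import HarnessLib

/-!
# Singlet rows for the half-filled Hubbard torus (R1/R2 certificate soundness, Lieb's Theorem 2)

HONEST FRAMING: ladder R1–R4 with certified numbers; no claim on H/H₀. This file is certificate
SOUNDNESS only (0 core-h): it adds no number to any table.

Companion of `ObservableWindowSinglet` (Heisenberg rows, Lieb–Mattis) for the FERMIONIC half of the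
ladder. For the repulsive Hubbard model on the even square torus `(ℤ/Lℤ)²` at half filling
(`N = L²`, `L` even, `t ≠ 0`, `U > 0`) Lieb's Theorem 2 — a tree theorem with all graph hypotheses
discharged, `LiebHalfFilled.hubbardTorus_exists_unit_groundState` — says the `L²`-particle ground
state `ψ₀` is unique and a singlet, `S² ψ₀ = 0`. Since
`S² = (S^z)² + ½ (S⁺ (S⁺)ᴴ + (S⁺)ᴴ S⁺)` is a positive combination of Gram squares (§1), this gives
the ANNIHILATORS `S⁺ ψ₀ = 0`, `S⁻ ψ₀ = (S⁺)ᴴ ψ₀ = 0`, `S^z ψ₀ = 0` on top of the sector ideal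
`(N̂ − L²) ψ₀ = 0` (§2, the menu `singletSectorAnn`). Consequently a `certsdp`-style identity may
contain, besides commutators `[H, X]`, arbitrary two-sided-ideal terms `Y·Z + Z'·Y'` with `Z, Z'`
drawn from `{N̂ − L², S^z, S⁺, (S⁺)ᴴ}` — in moment language: the linear rows
`⟨w S⁺_tot⟩ = ⟨S⁻_tot w⟩ = 0` for EVERY word `w`, which are NOT consequences of the `SU(2)`
Ward identities `⟨[S^α_tot, w]⟩ = 0` imposed by symmetry reduction — and the conclusion is still a
rigorous bound:

* §3 `groundEnergyAt_halfFilling_ge_of_certificate_singlet`: `c ≤ E₀(L²)` (R1 rows at `n = 1`);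
* §3 `re_expect_halfFilledGS_ge/le_of_windowCertificate_singlet`: window certificates (energy window
  `μ (E_up − H)`, `E₀(L²) ≤ E_up` from R1-var) bound `Re ⟨ψ, V ψ⟩` for every normalised
  `(L², S^z = 0)` sector ground state `ψ` (the `IsGroundStateInSector` quantifier of the cell's R2/R3
  rows; at half filling this is the unique ground state).

Away from half filling (or for `U < 0` with `N` odd, or on non-bipartite graphs) no such theorem is
available and these rows must NOT be used; at `U < 0`, `N` even, Lieb's Theorem 1 would give the same
rows (not typed here).

References: E.H. Lieb, *Two theorems on the Hubbard model*, PRL 62 (1989) 1201, Theorem 2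
[LiebPRL1989]; X. Han, *Quantum many-body bootstrap*, arXiv:2006.06002 §2 eq. (2)–(3)
[Han2020Bootstrap]; Wang et al., *Certifying ground-state properties of many-body systems*,
PRX 14 (2024) 031006 §3 eq. (4) [WangEtAl2024].
-/

namespace Summit.HubbardSuperconductivity.HubbardLadder

open Matrix Finset Literature.MathematicalPhysics.QuantumLattice
  Literature.MathematicalPhysics.QuantumManyBody.StateRelaxation
open scoped ComplexOrder

/-! ## §1 `S² ψ = 0` forces `S⁺ ψ = (S⁺)ᴴ ψ = S^z ψ = 0` -/

section Generic

variable {Λ : Type*} [LinearOrder Λ] [Fintype Λ]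

/-- **A singlet vector is killed by every spin component.** If `S² ψ = 0` then `S⁺ ψ = 0`,
`(S⁺)ᴴ ψ = S⁻ ψ = 0` and `S^z ψ = 0`, because
`0 = ⟨ψ, S² ψ⟩ = ‖S^z ψ‖² + ½ (‖(S⁺)ᴴ ψ‖² + ‖S⁺ ψ‖²)`. [folklore] -/
theorem spin_mulVec_eq_zero_of_spinSq_mulVec_eq_zero {ψ : Fock (Orb Λ)}
    (h : spinSq *ᵥ ψ = 0) :
    spinPlus *ᵥ ψ = 0 ∧ spinPlusᴴ *ᵥ ψ = 0 ∧ HubbardWave0.spinZ *ᵥ ψ = 0 := by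
  have hSz := (HubbardWave0.spinZ_isHermitian (Λ := Λ)).eq
  have ha : star ψ ⬝ᵥ ((HubbardWave0.spinZ * HubbardWave0.spinZ) *ᵥ ψ) =
      star (HubbardWave0.spinZ *ᵥ ψ) ⬝ᵥ (HubbardWave0.spinZ *ᵥ ψ) := by
    rw [star_mulVec, hSz, ← dotProduct_mulVec, mulVec_mulVec]
  have hb : star ψ ⬝ᵥ ((spinPlus * spinPlusᴴ) *ᵥ ψ) =
      star (spinPlusᴴ *ᵥ ψ) ⬝ᵥ (spinPlusᴴ *ᵥ ψ) := by
    rw [star_mulVec, conjTranspose_conjTranspose, ← dotProduct_mulVec, mulVec_mulVec]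
  have hc : star ψ ⬝ᵥ ((spinPlusᴴ * spinPlus) *ᵥ ψ) =
      star (spinPlus *ᵥ ψ) ⬝ᵥ (spinPlus *ᵥ ψ) := by
    rw [star_mulVec, ← dotProduct_mulVec, mulVec_mulVec]
  have hsum : star ψ ⬝ᵥ (spinSq *ᵥ ψ) =
      star (HubbardWave0.spinZ *ᵥ ψ) ⬝ᵥ (HubbardWave0.spinZ *ᵥ ψ) +
        (1 / 2 : ℂ) * (star (spinPlusᴴ *ᵥ ψ) ⬝ᵥ (spinPlusᴴ *ᵥ ψ) +
          star (spinPlus *ᵥ ψ) ⬝ᵥ (spinPlus *ᵥ ψ)) := by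
    rw [spinSq, add_mulVec, smul_mulVec, add_mulVec, dotProduct_add, dotProduct_smul,
      dotProduct_add, ha, hb, hc, smul_eq_mul]
  rw [h, dotProduct_zero] at hsum
  have h1 : 0 ≤ star (HubbardWave0.spinZ *ᵥ ψ) ⬝ᵥ (HubbardWave0.spinZ *ᵥ ψ) :=
    dotProduct_star_self_nonneg _
  have h2 : 0 ≤ star (spinPlusᴴ *ᵥ ψ) ⬝ᵥ (spinPlusᴴ *ᵥ ψ) := dotProduct_star_self_nonneg _
  have h3 : 0 ≤ star (spinPlus *ᵥ ψ) ⬝ᵥ (spinPlus *ᵥ ψ) := dotProduct_star_self_nonneg _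
  have hhalf : (0 : ℂ) ≤ 1 / 2 := by
    rw [show (1 / 2 : ℂ) = ((1 / 2 : ℝ) : ℂ) by push_cast; ring]
    exact Complex.zero_le_real.2 (by norm_num)
  have h23 : 0 ≤ (1 / 2 : ℂ) * (star (spinPlusᴴ *ᵥ ψ) ⬝ᵥ (spinPlusᴴ *ᵥ ψ) +
      star (spinPlus *ᵥ ψ) ⬝ᵥ (spinPlus *ᵥ ψ)) := mul_nonneg hhalf (add_nonneg h2 h3)
  obtain ⟨hz1, hz23⟩ := (add_eq_zero_iff_of_nonneg h1 h23).1 hsum.symm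
  have hz23' : star (spinPlusᴴ *ᵥ ψ) ⬝ᵥ (spinPlusᴴ *ᵥ ψ) +
      star (spinPlus *ᵥ ψ) ⬝ᵥ (spinPlus *ᵥ ψ) = 0 := by
    rcases mul_eq_zero.1 hz23 with h0 | h0
    · norm_num at h0
    · exact h0
  obtain ⟨hz2, hz3⟩ := (add_eq_zero_iff_of_nonneg h2 h3).1 hz23'
  exact ⟨dotProduct_star_self_eq_zero.1 hz3, dotProduct_star_self_eq_zero.1 hz2,
    dotProduct_star_self_eq_zero.1 hz1⟩

/-! ## §2 The menu of annihilators of a singlet `N`-particle vector -/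

/-- The four SECTOR/SINGLET ANNIHILATORS available in a certificate evaluated on an `N`-particle
singlet vector: `N̂ − N`, `S^z`, `S⁺ = Σ_x c†_{x↑} c_{x↓}`, `(S⁺)ᴴ = S⁻`. [folklore] -/
noncomputable def singletSectorAnn (N : ℕ) :
    Fin 4 → Matrix (Finset (Orb Λ)) (Finset (Orb Λ)) ℂ :=
  ![totalNumberOp - (N : ℂ) • 1, HubbardWave0.spinZ, spinPlus, spinPlusᴴ]

/-- Each annihilator of the menu kills an `N`-particle singlet vector. [folklore] -/
theorem singletSectorAnn_mulVec_eq_zero (N : ℕ) {ψ : Fock (Orb Λ)} (hN : IsNParticle N ψ)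
    (hS : spinSq *ᵥ ψ = 0) (i : Fin 4) : singletSectorAnn N i *ᵥ ψ = 0 := by
  obtain ⟨hP, hM, hZ⟩ := spin_mulVec_eq_zero_of_spinSq_mulVec_eq_zero hS
  fin_cases i
  · exact totalNumberOp_sub_mulVec_of_isNParticle N hN
  · exact hZ
  · exact hP
  · exact hM

/-- The menu is closed under adjoints, so the adjoints kill the vector too (needed for the
right-ideal terms `Z'·Y'`). [folklore] -/
theorem conjTranspose_singletSectorAnn_mulVec_eq_zero (N : ℕ) {ψ : Fock (Orb Λ)}
    (hN : IsNParticle N ψ) (hS : spinSq *ᵥ ψ = 0) (i : Fin 4) :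
    (singletSectorAnn N i)ᴴ *ᵥ ψ = 0 := by
  obtain ⟨hP, hM, hZ⟩ := spin_mulVec_eq_zero_of_spinSq_mulVec_eq_zero hS
  fin_cases i
  · show (totalNumberOp - (N : ℂ) • 1)ᴴ *ᵥ ψ = 0
    rw [conjTranspose_totalNumberOp_sub]; exact totalNumberOp_sub_mulVec_of_isNParticle N hN
  · show (HubbardWave0.spinZ)ᴴ *ᵥ ψ = 0
    rw [(HubbardWave0.spinZ_isHermitian (Λ := Λ)).eq]; exact hZ
  · exact hM
  · show (spinPlusᴴ)ᴴ *ᵥ ψ = 0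
    rw [conjTranspose_conjTranspose]; exact hP

end Generic

/-! ## §3 The even square torus at half filling -/

section Torus

variable (L : ℕ) [NeZero L]

omit [NeZero L] in
/-- A `(L², S^z = 0)` sector ground state of the Hubbard torus is an `L²`-particle vector with
`H ψ = E₀(L²) ψ` (`E₀(L²) = groundEnergyAt`, the `L²`-sector ground energy: every even-`N` sector
level is attained at `S^z = 0`, `groundEnergyAt_eq_minEnergyOn_szSector`). [folklore] -/
theorem halfFilled_sectorGS_eigen (hL : Even L) (t U : ℝ) {ψ : Fock (Orb (FermionTorus 2 L))}
    (hψ : IsGroundStateInSector (hubbardTorus 2 L t U) (L ^ 2) 0 ψ) :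
    IsNParticle (L ^ 2) ψ ∧ hubbardTorus 2 L t U *ᵥ ψ =
      ((groundEnergyAt (fermionTorusGraph 2 L) t U (L ^ 2) : ℝ) : ℂ) • ψ := by
  refine ⟨((mem_szSector_iff _ _ _).1 hψ.1).1, ?_⟩
  have hE2 : Even (L ^ 2) := by rw [sq]; exact hL.mul_right L
  have hn : L ^ 2 / 2 ≤ Fintype.card (FermionTorus 2 L) := by
    rw [show Fintype.card (FermionTorus 2 L) = L ^ 2 by
      simp only [FermionTorus, Fintype.card_lex, Fintype.card_fun, Fintype.card_fin]]
    exact Nat.div_le_self _ _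
  have h := groundEnergyAt_eq_minEnergyOn_szSector (fermionTorusGraph 2 L) t U hn
  rw [Nat.two_mul_div_two_of_even hE2] at h
  have h' : groundEnergyAt (fermionTorusGraph 2 L) t U (L ^ 2) =
      (hubbardTorus 2 L t U).minEnergyOn (szSector (L ^ 2) 0) := h
  rw [hψ.2.2, h']

/-- **Half-filled sector ground states are singlets** (Lieb's Theorem 2 on the even torus, via the
uniqueness clause of `LiebHalfFilled.hubbardTorus_exists_unit_groundState`): an `L²`-particle
`φ` with `H φ = E₀(L²) φ` has `S² φ = 0`. [cite: LiebPRL1989, Theorem 2] -/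
theorem spinSq_mulVec_eq_zero_of_halfFilled_eigen (hL : Even L) {t U : ℝ} (ht : t ≠ 0)
    (hU : 0 < U) {φ : Fock (Orb (FermionTorus 2 L))} (hN : IsNParticle (L ^ 2) φ)
    (hHφ : hubbardTorus 2 L t U *ᵥ φ =
      ((groundEnergyAt (fermionTorusGraph 2 L) t U (L ^ 2) : ℝ) : ℂ) • φ) :
    spinSq *ᵥ φ = 0 := by
  obtain ⟨ψ, -, -, -, hS, huniq, -⟩ := LiebHalfFilled.hubbardTorus_exists_unit_groundState
    (L := L) hL ht hU
  rw [huniq φ hN hHφ, mulVec_smul, hS, smul_zero]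

variable {m : Type*} [Fintype m] [DecidableEq m]

/-- **Singlet-row certificate ⇒ half-filled ground-energy lower bound (R1 rows at `n = 1`).** For
even `L`, `t ≠ 0`, `U > 0`: an identity
`H − c·1 = Σ Λᵢⱼ Oᵢᴴ Oⱼ + (Σ_k (H X_k − X_k H) + Σ_q (Y_q Z_{a q} + Z_{a' q} Y'_q))`, `Λ ⪰ 0`, with
`Z` drawn from the menu `{N̂ − L², S^z, S⁺, (S⁺)ᴴ}` (`singletSectorAnn (L²)`), proves
`c ≤ E₀(L²) = groundEnergyAt (fermionTorusGraph 2 L) t U (L²)` — evaluate in THE half-filled ground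
state, a singlet (`eigenvalue_ge_of_certificate`). [cite: LiebPRL1989, Theorem 2] -/
theorem groundEnergyAt_halfFilling_ge_of_certificate_singlet (hL : Even L) {t U : ℝ} (ht : t ≠ 0)
    (hU : 0 < U) {Λm : Matrix m m ℂ} (hΛ : Λm.PosSemidef)
    (O : m → Matrix (Finset (Orb (FermionTorus 2 L))) (Finset (Orb (FermionTorus 2 L))) ℂ)
    {κ : Type*} (s : Finset κ)
    (X : κ → Matrix (Finset (Orb (FermionTorus 2 L))) (Finset (Orb (FermionTorus 2 L))) ℂ)
    {ι : Type*} (t' : Finset ι)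
    (Y Y' : ι → Matrix (Finset (Orb (FermionTorus 2 L))) (Finset (Orb (FermionTorus 2 L))) ℂ)
    (a a' : ι → Fin 4) {c : ℝ}
    (hcert : hubbardTorus 2 L t U - (c : ℂ) • 1 =
      gramForm Λm O + (∑ k ∈ s, (hubbardTorus 2 L t U * X k - X k * hubbardTorus 2 L t U) +
        ∑ q ∈ t', (Y q * singletSectorAnn (L ^ 2) (a q) + singletSectorAnn (L ^ 2) (a' q) * Y' q))) :
    c ≤ groundEnergyAt (fermionTorusGraph 2 L) t U (L ^ 2) := by
  obtain ⟨ψ, hψK, h1, hHψ, hS, -, -⟩ := LiebHalfFilled.hubbardTorus_exists_unit_groundState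
    (L := L) hL ht hU
  have hN : IsNParticle (L ^ 2) ψ := ((mem_szSector_iff _ _ _).1 hψK).1
  exact eigenvalue_ge_of_certificate (LiebThm1.hamiltonian_isHermitian (fermionTorusGraph 2 L) t U)
    h1 hHψ hΛ O s X t' Y (fun q => singletSectorAnn (L ^ 2) (a q))
    (fun q => singletSectorAnn (L ^ 2) (a' q)) Y'
    (fun q _ => singletSectorAnn_mulVec_eq_zero (L ^ 2) hN hS (a q))
    (fun q _ => conjTranspose_singletSectorAnn_mulVec_eq_zero (L ^ 2) hN hS (a' q)) hcert

/-- **Singlet-row WINDOW certificate ⇒ observable lower bound in every half-filled sector ground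
state (R2 rows at `n = 1`; the R2 ⇒ R3 edge shape).** With an energy window `μ (E_up − H)`,
`μ ≥ 0`, `E₀(L²) ≤ E_up` (a certified variational upper bound), commutators and menu ideal terms as
in `groundEnergyAt_halfFilling_ge_of_certificate_singlet`, an identity for `V − c·1` proves
`c ≤ Re ⟨ψ, V ψ⟩` for every normalised `(L², S^z = 0)` sector ground state `ψ`
(`re_vectorState_ge_of_windowCertificate`; at half filling `ψ` is THE ground state).
[cite: WangEtAl2024, §3 eq. (4)] -/
theorem re_expect_halfFilledGS_ge_of_windowCertificate_singlet (hL : Even L) {t U : ℝ}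
    (ht : t ≠ 0) (hU : 0 < U) {Λm : Matrix m m ℂ} (hΛ : Λm.PosSemidef)
    (O : m → Matrix (Finset (Orb (FermionTorus 2 L))) (Finset (Orb (FermionTorus 2 L))) ℂ)
    {κ : Type*} (s : Finset κ)
    (X : κ → Matrix (Finset (Orb (FermionTorus 2 L))) (Finset (Orb (FermionTorus 2 L))) ℂ)
    {ι : Type*} (t' : Finset ι)
    (Y Y' : ι → Matrix (Finset (Orb (FermionTorus 2 L))) (Finset (Orb (FermionTorus 2 L))) ℂ)
    (a a' : ι → Fin 4)
    {V : Matrix (Finset (Orb (FermionTorus 2 L))) (Finset (Orb (FermionTorus 2 L))) ℂ}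
    {Eup μ c : ℝ} (hμ : 0 ≤ μ) (hE : groundEnergyAt (fermionTorusGraph 2 L) t U (L ^ 2) ≤ Eup)
    (hcert : V - (c : ℂ) • 1 =
      gramForm Λm O + (∑ k ∈ s, (hubbardTorus 2 L t U * X k - X k * hubbardTorus 2 L t U) +
        ∑ q ∈ t', (Y q * singletSectorAnn (L ^ 2) (a q) + singletSectorAnn (L ^ 2) (a' q) * Y' q)) +
        (μ : ℂ) • ((Eup : ℂ) • 1 - hubbardTorus 2 L t U)) :
    ∀ ψ : Fock (Orb (FermionTorus 2 L)), star ψ ⬝ᵥ ψ = 1 →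
      IsGroundStateInSector (hubbardTorus 2 L t U) (L ^ 2) 0 ψ → c ≤ (star ψ ⬝ᵥ V *ᵥ ψ).re := by
  intro ψ h1 hgs
  obtain ⟨hN, hHψ⟩ := halfFilled_sectorGS_eigen L hL t U hgs
  have hS := spinSq_mulVec_eq_zero_of_halfFilled_eigen L hL ht hU hN hHψ
  exact re_vectorState_ge_of_windowCertificate
    (LiebThm1.hamiltonian_isHermitian (fermionTorusGraph 2 L) t U) h1 hHψ hΛ O s X t' Y
    (fun q => singletSectorAnn (L ^ 2) (a q)) (fun q => singletSectorAnn (L ^ 2) (a' q)) Y'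
    (fun q _ => singletSectorAnn_mulVec_eq_zero (L ^ 2) hN hS (a q))
    (fun q _ => conjTranspose_singletSectorAnn_mulVec_eq_zero (L ^ 2) hN hS (a' q)) hμ hE hcert

/-- Upper-bound form of `re_expect_halfFilledGS_ge_of_windowCertificate_singlet`: a certificate for
`−V − c·1` proves `Re ⟨ψ, V ψ⟩ ≤ −c`. [cite: WangEtAl2024, §3 eq. (4)] -/
theorem re_expect_halfFilledGS_le_of_windowCertificate_singlet (hL : Even L) {t U : ℝ}
    (ht : t ≠ 0) (hU : 0 < U) {Λm : Matrix m m ℂ} (hΛ : Λm.PosSemidef)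
    (O : m → Matrix (Finset (Orb (FermionTorus 2 L))) (Finset (Orb (FermionTorus 2 L))) ℂ)
    {κ : Type*} (s : Finset κ)
    (X : κ → Matrix (Finset (Orb (FermionTorus 2 L))) (Finset (Orb (FermionTorus 2 L))) ℂ)
    {ι : Type*} (t' : Finset ι)
    (Y Y' : ι → Matrix (Finset (Orb (FermionTorus 2 L))) (Finset (Orb (FermionTorus 2 L))) ℂ)
    (a a' : ι → Fin 4)
    {V : Matrix (Finset (Orb (FermionTorus 2 L))) (Finset (Orb (FermionTorus 2 L))) ℂ}
    {Eup μ c : ℝ} (hμ : 0 ≤ μ) (hE : groundEnergyAt (fermionTorusGraph 2 L) t U (L ^ 2) ≤ Eup)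
    (hcert : -V - (c : ℂ) • 1 =
      gramForm Λm O + (∑ k ∈ s, (hubbardTorus 2 L t U * X k - X k * hubbardTorus 2 L t U) +
        ∑ q ∈ t', (Y q * singletSectorAnn (L ^ 2) (a q) + singletSectorAnn (L ^ 2) (a' q) * Y' q)) +
        (μ : ℂ) • ((Eup : ℂ) • 1 - hubbardTorus 2 L t U)) :
    ∀ ψ : Fock (Orb (FermionTorus 2 L)), star ψ ⬝ᵥ ψ = 1 →
      IsGroundStateInSector (hubbardTorus 2 L t U) (L ^ 2) 0 ψ → (star ψ ⬝ᵥ V *ᵥ ψ).re ≤ -c := by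
  intro ψ h1 hgs
  obtain ⟨hN, hHψ⟩ := halfFilled_sectorGS_eigen L hL t U hgs
  have hS := spinSq_mulVec_eq_zero_of_halfFilled_eigen L hL ht hU hN hHψ
  exact re_vectorState_le_of_windowCertificate
    (LiebThm1.hamiltonian_isHermitian (fermionTorusGraph 2 L) t U) h1 hHψ hΛ O s X t' Y
    (fun q => singletSectorAnn (L ^ 2) (a q)) (fun q => singletSectorAnn (L ^ 2) (a' q)) Y'
    (fun q _ => singletSectorAnn_mulVec_eq_zero (L ^ 2) hN hS (a q))
    (fun q _ => conjTranspose_singletSectorAnn_mulVec_eq_zero (L ^ 2) hN hS (a' q)) hμ hE hcert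

end Torus

end Summit.HubbardSuperconductivity.HubbardLadder
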